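import Summits.QuantumFields.YangMills.Theorems.BalabanUVNodesN15KingModelThm33AtRegularFieldRegionUnit
import Summits.QuantumFields.YangMills.Theorems.BalabanUVNodesN15KingModelThm33AtRegularFieldRegionFine
import Summits.QuantumFields.YangMills.Theorems.BalabanUVNodesN15KingModelThm33AtRegularFieldBoxFine
import Summits.QuantumFields.YangMills.Theorems.BalabanUVNodesN15KingModelThm33AtRegularFieldDeltaNearBoundary
import Summits.QuantumFields.YangMills.Theorems.BalabanUVNodesN15KingModelB9Thm315AtRegularField

/-!
# Route «BalabanUVNodes», node N15 = NE2 — THE KING-MODEL RUNG, PART Θ⁺⁺⁺-c (assembly): KING 1986 THEOREM 3.3 **BY NAME AT A REGULAR BACKGROUND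
# `A ≠ 0` ON A BIG-BLOCK BOX `Ω ⊊ T_ε`, THE `δ`-CLAUSES LIVE, WITHOUT THE `R₀`-INTERIOR RESTRICTION** — King's «rectangular parallelepiped which is a
# union of large blocks», observation points and sources on ALL bond-closed sites of `Ω`

Cell `pub-ymgap`, Track A (D-0062), seat `pub-ymgap-dag-n15-e` (R141 (C), s3), generation 21; assembles PARTS Θ⁺⁺-b (`region_unit_clauses`), Θ⁺⁺-c
(`region_fine_clauses`, at `Ω` for the `R₀`-interior points and at `T_ε` for all points), Θ⁺⁺⁺-a (`box_fine_clauses`) and Θ⁺⁺⁺-b (`deltaG_near`,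
`deltaDG_near`, `deltaHolder_far`, `deltaHolder_near`).  `bears_on: R4∕N15`; `--supports stmt-QuantumFields-27366` (K3⁸, `--as helper`).  COUNT-NEUTRAL.

THE PRINT.  [King1986] Theorem 3.3 pp. 655–656 (verbatim in `ContinuumLimit.Thm33Printed`): *«Let A be regular on Ω_η, with η = L^{−k}, and let Ω^{(k)} be a
rectangular parallelepiped which is a union of large blocks on T₁^{(k)}. Then for all k ≤ K, some δ₀ > 0, 0 < α < 1, and for f : Ω_η → R^N, [(3.6), (3.7),
(3.8)]. Finally, define δC^{(k)}(Ω, A) = C^{(k)}(Ω, A) − C^{(k)}(A) and δG_k(Ω, A) = G_k(Ω, A) − G_k(A); then … with the additional factors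
exp[−δ₀ dist({x, y}, ∂Ω)] and exp[−δ₀ dist({x, y}, ∂Ω) − δ₀ dist(supp f, ∂Ω)] respectively …  Theorem 3.3 is proved in [Ba 4].»*

WHAT THIS FILE PROVES (0 `sorry`, no `def`).  ★★★ **`thm33Printed_king_regularField_box`**: for `d ≥ 1`, `L` odd `> 1`, `a, m² > 0`, `N`, `(e, q)` there
are `K₀min` and, for every cube size `K₀ ≥ K₀min` with `L ∣ K₀`, a threshold `t > 0` such that for every cubic torus of r14's sub-family (`Shape P`,
`K₀ ∣ M`, `3K₀ ≤ 2M`), every level `1 ≤ k < K_P` with `L^kε ≤ 1`, EVERY CELL-PRODUCT BOX OF LARGE BLOCKS `Ω = cellBox k K₀ S`, every admissible contour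
system `Γ` INSIDE `Ω` (`IsAdm y x (Γ y x)`, `Γ y x ⊂ Ω` for `x, y ∈ Ω`) and every field `A` with one-step differences `≤ δ`, `L^k·δ·|e| ≤ t`:
`Thm33Printed (kingThm33DataAlong C P k Ω (bset Ω) Γ A a m²)` with `α = ½` — the fine carrier is ALL of `bset Ω` (the sites of `Ω` whose forward bonds lie
in `Ω`), NO `R₀`-restriction.  The nine clauses: (3.6)×2 and `δC` ⇐ Θ⁺⁺-b (every carrier); (3.7)×2, (3.8) at every point ∕ bond ∕ pair ⇐ Θ⁺⁺⁺-a (p26∕p35's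
`R₀`-free box theorems); the three `δG` clauses: at `R₀`-interior points ⇐ Θ⁺⁺-c ([Ba1] (2.26) under `R₀`), at points within `R₀ ≤ (2d+7)K₀L^k` of `Ωᶜ`
⇐ Θ⁺⁺⁺-b from the box bound for `G_k(Ω, A)` and the torus bound for `G_k(A)` (Θ⁺⁺-c at `Ω = T_ε`), Hölder pairs `≥ L^k` apart from the pointwise
derivative clauses, closer pairs near `∂Ω` from the two (3.8) bounds.  + `thm33Printed_king_box_of_isRegular35` (King Def 3.2 (3.5) BY NAME as hypothesis).
[cite: King1986, Thm 3.3 (3.6)–(3.8) pp.655–656] [cite: Balaban1982Higgs1, Prop. 2.1 (2.24)–(2.26) p.610, p.611 l.1–2, Prop. 2.2 (2.27), Prop. 2.3 (2.34)–(2.38) pp.611–612]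
[cite: Balaban1983RegularityDecay, Theorem (1.9)–(1.12) p.573, p.579, Prop. 2.3 p.574]

HONEST FRAMING ∕ SCOPE.  (i) A KNIT; no estimate is new; the near-boundary `δ`-clauses cost the constant `e^{δ₀(2d+7)K₀·3∕2+…}` (per cube size, as every
constant here) and the rate `δ₀∕2`.  (ii) «Rectangular parallelepiped» ↦ p35's `cellBox k K₀ S` with the transports read along a contour system `Γ ⊂ Ω` (needed only
for (3.8): the tree's box Hölder theorem wants the contour inside `Ω`; PART Θ⁺⁺-a′ makes `Γ` a parameter of the datum); for a product of cell intervals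
at most half the torus the coordinatewise shortest staircase qualifies — PART Θ⁺⁺⁺-d `…IntervalBox` (`legsK_subset_intervalBox`,
`thm33Printed_king_regularField_intervalBox`).  (iii) Fine carrier `bset Ω` (sites with all `d` forward
bonds in `Ω`): the last layer of sites of `Ω` below its upper faces carries no forward bond of `Ω` in that direction and is not an observation point — King's
`Ω_η` read as the bond-closed part.  (iv) Regularity `|ΔA| ≤ δ` on all of `T_ε` (the `δ`-operators involve `G_k(A)` on `T_ε`); cubic tori; `L ∣ K₀`;
`m² > 0`; `1 ≤ k < K_P`; `L^kε ≤ 1`; constants per `K₀`.  NOT Bałaban's non-abelian `G(U)`; NE2⁺ NOT printed ∕ not proved; NOT a node discharge; counts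
untouched; nothing continuum ∕ ℝ⁴ ∕ OS ∕ mass-gap ∕ Clay.
-/

noncomputable section

namespace Summit.QuantumFields.YangMills.BalabanUVNodes.N15KingModelRung.Curved

open Literature.MathematicalPhysics.QuantumFieldTheory.Balaban1983to89
open Literature.MathematicalPhysics.QuantumFieldTheory.Balaban1983to89.HiggsLattice (ChargeData)
open Literature.MathematicalPhysics.QuantumFieldTheory.Balaban1983to89.B1Eq211ZeroFieldTorus (Shape)
open Literature.MathematicalPhysics.QuantumFieldTheory.Balaban1983to89.B1TorusRegionHSizes (IsBigBlockUnion isBigBlockUnion_univ)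
open Literature.MathematicalPhysics.QuantumFieldTheory.Balaban1983to89.B1Ineq225RegularBox (cellBox isBigBlockUnion_cellBox)
open Literature.MathematicalPhysics.QuantumFieldTheory.Balaban1983to89.B3Ineq211RegularTorus (IsAdm)
open Literature.MathematicalPhysics.QuantumFieldTheory.King1986.ContinuumLimit (Thm33Data Thm33Printed IsRegular35)

variable {N : ℕ}

set_option maxHeartbeats 400000 in
/-- ★★★ **KING 1986 THEOREM 3.3 BY NAME AT A REGULAR BACKGROUND ON A BIG-BLOCK BOX `Ω ⊂ T_ε`, TRANSPORTS ALONG ANY ADMISSIBLE CONTOUR SYSTEM INSIDE `Ω`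
— ALL NINE CLAUSES, THE `δ`-CLAUSES LIVE, NO `R₀`-RESTRICTION** (statement and sources in the module docstring; PART Θ⁺⁺⁺-d discharges the contour
hypothesis for interval boxes with the coordinate staircases). [cite: King1986, Thm 3.3 (3.6)–(3.8) pp.655–656]
[cite: Balaban1982Higgs1, Prop. 2.1 (2.24)–(2.26) p.610, p.611 l.1–2, Prop. 2.3 (2.34)–(2.38) pp.611–612] [cite: Balaban1983RegularityDecay, Theorem (1.9)–(1.12) p.573, p.579] -/
theorem thm33Printed_king_regularField_box (d L : ℕ) (hd : 1 ≤ d) (hL : Odd L ∧ 1 < L) {a msq : ℝ} (ha : 0 < a) (hmsq : 0 < msq)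
    (N : ℕ) (C : ChargeData N) :
    ∃ K₀min : ℕ, ∀ K₀ : ℕ, K₀min ≤ K₀ → L ∣ K₀ → ∃ t : ℝ, 0 < t ∧
      ∀ (P : HiggsLattice.Params) (_S : Shape P), P.d = d → P.L = L → K₀ ∣ P.M → 3 * K₀ ≤ 2 * P.M →
      ∀ {k : ℕ}, 1 ≤ k → k < P.K → P.mesh k ≤ 1 →
      ∀ (Sc : Fin P.d → Finset ℕ) (Γ : HiggsLattice.Site P 0 → HiggsLattice.Site P 0 → List (HiggsLattice.Site P 0)), (∀ y x, IsAdm y x (Γ y x)) →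
        (∀ x y : HiggsLattice.Site P 0, x ∈ cellBox k K₀ Sc → y ∈ cellBox k K₀ Sc → ∀ z ∈ Γ y x, z ∈ cellBox k K₀ Sc) →
      ∀ (A : HiggsLattice.VecField P 0) {δ : ℝ}, 0 ≤ δ →
        (∀ (z : HiggsLattice.Site P 0) (μ ν : Fin P.d), |A ⟨z.shift ν, μ⟩ - A ⟨z, μ⟩| ≤ δ) →
        (P.L : ℝ) ^ k * δ * |C.e| ≤ t →
        Thm33Printed (kingThm33DataAlong C P k (cellBox k K₀ Sc) (bset (cellBox k K₀ Sc)) Γ A a msq) := by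
  obtain ⟨Ku, hU⟩ := region_unit_clauses d L hL ha hmsq N C
  obtain ⟨Kf, hF⟩ := region_fine_clauses d L hd hL ha hmsq N C
  obtain ⟨Kb, hB⟩ := box_fine_clauses d L hd hL ha hmsq N C
  refine ⟨max (max Ku Kf) (max Kb 1), fun K₀ hK₀ hLK₀ => ?_⟩
  obtain ⟨⟨hKu, hKf⟩, hKb, hK₀1⟩ : (Ku ≤ K₀ ∧ Kf ≤ K₀) ∧ Kb ≤ K₀ ∧ 1 ≤ K₀ := by simp only [max_le_iff] at hK₀; exact hK₀
  obtain ⟨tu, htu, hU'⟩ := hU K₀ hKu hLK₀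
  obtain ⟨tf, htf, hF'⟩ := hF K₀ hKf
  obtain ⟨tb, htb, hB'⟩ := hB K₀ hKb
  clear hU hF hB
  refine ⟨min tu (min tf tb), lt_min htu (lt_min htf htb), ?_⟩
  intro P S hPd hPL hK₀M h3M k hk1 hkK hs Sc Γ hΓ hconv A δ hδ hreg ht
  have htu' := ht.trans (min_le_left _ _)
  have htf' := ht.trans ((min_le_right _ _).trans (min_le_left _ _))
  have htb' := ht.trans ((min_le_right _ _).trans (min_le_right _ _))
  have hΩbig : IsBigBlockUnion k K₀ (cellBox k K₀ Sc) := isBigBlockUnion_cellBox Sc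
  obtain ⟨Cu, δu, hCu, hδu, hU''⟩ := hU' P S hPd hPL hK₀M h3M hk1 hkK hs (cellBox k K₀ Sc) hΩbig (bset (cellBox k K₀ Sc)) Γ A hδ hreg htu'
  obtain ⟨Cf, δf, hCf, hδf, hF''⟩ := hF' P hPd hPL hK₀M h3M hk1 hkK hs (cellBox k K₀ Sc) hΩbig (bset (cellBox k K₀ Sc)) Γ hΓ A hδ hreg htf'
  obtain ⟨Ct, δt, hCt, hδt, hT''⟩ := hF' P hPd hPL hK₀M h3M hk1 hkK hs Finset.univ isBigBlockUnion_univ (bset (cellBox k K₀ Sc)) Γ hΓ A hδ hreg htf'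
  obtain ⟨Cb, δb, hCb, hδb, hB''⟩ := hB' P hPd hPL hK₀M h3M hk1 hkK hs Sc (bset (cellBox k K₀ Sc)) Γ hΓ A hδ hreg htb'
  clear hU' hF' hB'
  -- common constants for the inputs
  obtain ⟨C₀, hC₀def⟩ : ∃ C₀ : ℝ, C₀ = Cu + Cf + Ct + Cb := ⟨_, rfl⟩
  have hC₀u : Cu ≤ C₀ := by rw [hC₀def]; linarith only [hCf.le, hCt.le, hCb.le]
  have hC₀f : Cf ≤ C₀ := by rw [hC₀def]; linarith only [hCu.le, hCt.le, hCb.le]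
  have hC₀t : Ct ≤ C₀ := by rw [hC₀def]; linarith only [hCu.le, hCf.le, hCb.le]
  have hC₀b : Cb ≤ C₀ := by rw [hC₀def]; linarith only [hCu.le, hCf.le, hCt.le]
  have hC₀ : 0 ≤ C₀ := hCu.le.trans hC₀u
  obtain ⟨r, hrdef⟩ : ∃ r : ℝ, r = min δu (min δf (min δt δb)) := ⟨_, rfl⟩
  have hr : 0 < r := by rw [hrdef]; exact lt_min hδu (lt_min hδf (lt_min hδt hδb))
  have hru : r ≤ δu := by rw [hrdef]; exact min_le_left _ _
  have hrf : r ≤ δf := by rw [hrdef]; exact (min_le_right _ _).trans (min_le_left _ _)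
  have hrt : r ≤ δt := by rw [hrdef]; exact (min_le_right _ _).trans ((min_le_right _ _).trans (min_le_left _ _))
  have hrb : r ≤ δb := by rw [hrdef]; exact (min_le_right _ _).trans ((min_le_right _ _).trans (min_le_right _ _))
  obtain ⟨hfG, hfDG, hfH, hfδG, hfδDG, hfδH⟩ := hF'' C₀ r hC₀f hr hrf _ rfl
  obtain ⟨htG, htDG, htH, -, -, -⟩ := hT'' C₀ r hC₀t hr hrt _ rfl
  obtain ⟨hbG, hbDG, hbH⟩ := hB'' C₀ r hC₀b hr hrb _ rfl
  clear hfG hfDG hfH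
  have hIu : ∀ x : HiggsLattice.Site P 0, x ∈ intSet k K₀ (Finset.univ : Finset (HiggsLattice.Site P 0)) :=
    fun x => mem_intSet.2 fun y _ => Finset.mem_univ _
  -- the near-boundary radius `R = (2d+7)K₀` (in units of `L^k`)
  obtain ⟨R, hRdef⟩ : ∃ R : ℝ, R = (2 * (P.d : ℝ) + 7) * K₀ := ⟨_, rfl⟩
  have hR0 : 0 ≤ R := by rw [hRdef]; positivity
  have hnear : ∀ x : HiggsLattice.Site P 0, x ∉ intSet k K₀ (cellBox k K₀ Sc) → bdistΩ (cellBox k K₀ Sc) x ≤ R * (P.L : ℝ) ^ k :=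
    fun x hx => (bdistΩ_le_intRad_of_not_mem hx).trans (by rw [hRdef]; exact intRad_le hK₀1)
  -- the final constants
  obtain ⟨C₁, hC₁def⟩ : ∃ C₁ : ℝ, C₁ = (C₀ + C₀) * Real.exp (r * R) := ⟨_, rfl⟩
  have hC₁0 : 0 ≤ C₁ := by rw [hC₁def]; positivity
  have hC₀C₁ : C₀ ≤ C₁ := by
    rw [hC₁def]
    have h1 : (1 : ℝ) ≤ Real.exp (r * R) := Real.one_le_exp (by positivity)
    nlinarith only [hC₀, h1]
  obtain ⟨Cfin, hCfindef⟩ : ∃ Cfin : ℝ, Cfin = 2 * C₁ + (C₀ + C₀) * Real.exp (r / 2 * (3 * R + 2)) := ⟨_, rfl⟩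
  have hE0 : 0 ≤ (C₀ + C₀) * Real.exp (r / 2 * (3 * R + 2)) := by positivity
  have hC₁fin : C₁ ≤ Cfin := by rw [hCfindef]; linarith only [hE0, hC₁0]
  have h2C₁fin : 2 * C₁ ≤ Cfin := by rw [hCfindef]; linarith only [hE0]
  have hNfin : (C₀ + C₀) * Real.exp (r / 2 * (3 * R + 2)) ≤ Cfin := by rw [hCfindef]; linarith only [hC₁0]
  have hC₀fin : C₀ ≤ Cfin := hC₀C₁.trans hC₁fin
  have hfin0 : 0 ≤ Cfin := hC₁0.trans hC₁fin
  have hr2 : 0 < r / 2 := by linarith only [hr]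
  have hr2le : r / 2 ≤ r := by linarith only [hr]
  -- the non-`δ` clauses at the final constants
  obtain ⟨h36a, h36b, hδC⟩ := hU'' Cfin (r / 2) (hC₀u.trans hC₀fin) hr2 (hr2le.trans hru)
  obtain ⟨hbG', hbDG', hbH'⟩ := hB'' Cfin (r / 2) (hC₀b.trans hC₀fin) hr2 (hr2le.trans hrb) _ rfl
  clear hU'' hB'' hT'' hF''
  -- nonnegativity of the datum's distances
  have hs0 := dsupp_nonneg C k (cellBox k K₀ Sc) (bset (cellBox k K₀ Sc)) Γ A a msq
  have hs20 := dsupp2_nonneg C k (cellBox k K₀ Sc) (bset (cellBox k K₀ Sc)) Γ A a msq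
  have hb0 := dbdryη_nonneg C k (cellBox k K₀ Sc) (bset (cellBox k K₀ Sc)) Γ A a msq
  have hq0 := dsuppbdry_nonneg C k (cellBox k K₀ Sc) (bset (cellBox k K₀ Sc)) Γ A a msq
  -- the pointwise `δ`-clauses for the value and the derivative at `(C₁, r∕2)`
  have hδGpt : ∀ f x, ‖(kingThm33DataAlong C P k (cellBox k K₀ Sc) (bset (cellBox k K₀ Sc)) Γ A a msq).δG f x‖ ≤ C₁ * Real.exp (-(r / 2 * (kingThm33DataAlong C P k (cellBox k K₀ Sc) (bset (cellBox k K₀ Sc)) Γ A a msq).dsupp f x)) * (kingThm33DataAlong C P k (cellBox k K₀ Sc) (bset (cellBox k K₀ Sc)) Γ A a msq).supNorm f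
      * Real.exp (-(r / 2 * (kingThm33DataAlong C P k (cellBox k K₀ Sc) (bset (cellBox k K₀ Sc)) Γ A a msq).dbdryη x x) - r / 2 * (kingThm33DataAlong C P k (cellBox k K₀ Sc) (bset (cellBox k K₀ Sc)) Γ A a msq).dsuppbdry f) := by
    intro f x
    by_cases hxI : x.1 ∈ intSet k K₀ (cellBox k K₀ Sc)
    · exact (hfδG f x hxI).trans (delta_weight_mono hC₀C₁ hC₁0 hr2le (hs0 f x) (norm_nonneg _) (hb0 x x) (hq0 f))
    · have h := deltaG_near C k (cellBox k K₀ Sc) (bset (cellBox k K₀ Sc)) Γ A a msq hC₀ hC₀ hr.le f x (hbG f x) (htG f x (hIu x.1)) (hnear x.1 hxI)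
      rw [← hC₁def] at h
      exact h
  have hδDGpt : ∀ μ f x, ‖(kingThm33DataAlong C P k (cellBox k K₀ Sc) (bset (cellBox k K₀ Sc)) Γ A a msq).δDG μ f x‖ ≤ C₁ * Real.exp (-(r / 2 * (kingThm33DataAlong C P k (cellBox k K₀ Sc) (bset (cellBox k K₀ Sc)) Γ A a msq).dsupp f x)) * (kingThm33DataAlong C P k (cellBox k K₀ Sc) (bset (cellBox k K₀ Sc)) Γ A a msq).supNorm f
      * Real.exp (-(r / 2 * (kingThm33DataAlong C P k (cellBox k K₀ Sc) (bset (cellBox k K₀ Sc)) Γ A a msq).dbdryη x x) - r / 2 * (kingThm33DataAlong C P k (cellBox k K₀ Sc) (bset (cellBox k K₀ Sc)) Γ A a msq).dsuppbdry f) := by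
    intro μ f x
    by_cases hxI : x.1 ∈ intSet k K₀ (cellBox k K₀ Sc)
    · exact (hfδDG μ f x hxI).trans (delta_weight_mono hC₀C₁ hC₁0 hr2le (hs0 f x) (norm_nonneg _) (hb0 x x) (hq0 f))
    · have h := deltaDG_near C k (cellBox k K₀ Sc) (bset (cellBox k K₀ Sc)) Γ A a msq hC₀ hC₀ hr.le μ f x (hbDG μ f x x.2) (htDG μ f x (hIu x.1)) (hnear x.1 hxI)
      rw [← hC₁def] at h
      exact h
  refine ⟨r / 2, 1 / 2, Cfin, hr2, by norm_num, by norm_num, h36a, h36b, hbG', fun μ f x => hbDG' μ f x x.2,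
    fun μ f x y hxy => hbH' μ f x y hxy x.2 y.2 (hconv x.1 y.1 (mem_bset.1 x.2).1 (mem_bset.1 y.2).1), hδC, ?_, ?_, ?_⟩
  · intro f x
    exact (hδGpt f x).trans (delta_weight_mono hC₁fin hfin0 le_rfl (hs0 f x) (norm_nonneg _) (hb0 x x) (hq0 f))
  · intro μ f x
    exact (hδDGpt μ f x).trans (delta_weight_mono hC₁fin hfin0 le_rfl (hs0 f x) (norm_nonneg _) (hb0 x x) (hq0 f))
  · intro μ f x y hxy
    by_cases hfar : (P.L : ℝ) ^ k ≤ (HiggsLattice.Site.tdist x.1 y.1 : ℝ)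
    · exact (deltaHolder_far C k (cellBox k K₀ Sc) (bset (cellBox k K₀ Sc)) Γ A a msq hC₁0 hr2.le μ f x y hfar (hδDGpt μ f x) (hδDGpt μ f y)).trans
        (delta_weight_mono h2C₁fin hfin0 le_rfl (hs20 f x y) (norm_nonneg _) (hb0 x y) (hq0 f))
    · have hclose : (HiggsLattice.Site.tdist x.1 y.1 : ℝ) ≤ (P.L : ℝ) ^ k := (not_le.1 hfar).le
      by_cases hint2 : x.1 ∈ intSet k K₀ (cellBox k K₀ Sc) ∧ y.1 ∈ intSet k K₀ (cellBox k K₀ Sc)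
      · exact (hfδH μ f x y hxy hint2.1 hint2.2).trans
          (delta_weight_mono hC₀fin hfin0 hr2le (hs20 f x y) (norm_nonneg _) (hb0 x y) (hq0 f))
      · have hnear2 : min (bdistΩ (cellBox k K₀ Sc) x.1) (bdistΩ (cellBox k K₀ Sc) y.1) ≤ R * (P.L : ℝ) ^ k := by
          rcases not_and_or.1 hint2 with hx | hy
          · exact (min_le_left _ _).trans (hnear x.1 hx)
          · exact (min_le_right _ _).trans (hnear y.1 hy)
        have h := deltaHolder_near C k (cellBox k K₀ Sc) (bset (cellBox k K₀ Sc)) Γ A a msq hC₀ hC₀ hr.le hR0 μ f x y hclose hnear2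
          (hbH μ f x y hxy x.2 y.2 (hconv x.1 y.1 (mem_bset.1 x.2).1 (mem_bset.1 y.2).1)) (htH μ f x y hxy (hIu x.1) (hIu y.1))
        exact h.trans (delta_weight_mono hNfin hfin0 le_rfl (hs20 f x y) (norm_nonneg _) (hb0 x y) (hq0 f))

/-- ★★ PART Θ⁺⁺⁺ WITH KING's DEFINITION 3.2 (3.5) BY NAME as the regularity hypothesis (`ContinuumLimit.IsRegular35` on the whole torus `T_η`, `η > 0`;
one-step form PART Θ⁺-b `oneStep_of_isRegular35`). [cite: King1986, Def. 3.2 (3.5) p.655, Thm 3.3 p.656] -/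
theorem thm33Printed_king_box_of_isRegular35 (d L : ℕ) (hd : 1 ≤ d) (hL : Odd L ∧ 1 < L) {a msq : ℝ} (ha : 0 < a) (hmsq : 0 < msq)
    (N : ℕ) (C : ChargeData N) :
    ∃ K₀min : ℕ, ∀ K₀ : ℕ, K₀min ≤ K₀ → L ∣ K₀ → ∃ t : ℝ, 0 < t ∧
      ∀ (P : HiggsLattice.Params) (_S : Shape P), P.d = d → P.L = L → K₀ ∣ P.M → 3 * K₀ ≤ 2 * P.M →
      ∀ {k : ℕ}, 1 ≤ k → k < P.K → P.mesh k ≤ 1 →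
      ∀ (Sc : Fin P.d → Finset ℕ) (Γ : HiggsLattice.Site P 0 → HiggsLattice.Site P 0 → List (HiggsLattice.Site P 0)), (∀ y x, IsAdm y x (Γ y x)) →
        (∀ x y : HiggsLattice.Site P 0, x ∈ cellBox k K₀ Sc → y ∈ cellBox k K₀ Sc → ∀ z ∈ Γ y x, z ∈ cellBox k K₀ Sc) →
      ∀ (A : HiggsLattice.VecField P 0) {η Cc e s β : ℝ}, 0 < η → IsRegular35 P 0 Set.univ η Cc e s β A →
        (P.L : ℝ) ^ k * (η * (Cc * (e * s ^ (2 - (P.d : ℝ) / 2)) ^ (β - 1))) * |C.e| ≤ t →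
        Thm33Printed (kingThm33DataAlong C P k (cellBox k K₀ Sc) (bset (cellBox k K₀ Sc)) Γ A a msq) := by
  obtain ⟨K₀min, h⟩ := thm33Printed_king_regularField_box d L hd hL ha hmsq N C
  refine ⟨K₀min, fun K₀ hK₀ hLK₀ => ?_⟩
  obtain ⟨t, ht, h'⟩ := h K₀ hK₀ hLK₀
  exact ⟨t, ht, fun P S hPd hPL hK₀M h3M k hk1 hkK hs Sc Γ hΓ hconv A η Cc e s β hη hreg hsmall =>
    h' P S hPd hPL hK₀M h3M hk1 hkK hs Sc Γ hΓ hconv A (mul_nonneg hη.le (isRegular35_rhs_nonneg hreg)) (oneStep_of_isRegular35 hη hreg) hsmall⟩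

end Summit.QuantumFields.YangMills.BalabanUVNodes.N15KingModelRung.Curved

end
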